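import Summits.ResolutionOfSingularities.ResolutionOfSingularities.Theorems.UniversalCellsLocalToGlobalTwoModelPatchingAt
import Literature.AlgebraicGeometry.Resolution.AffineDomainDimension
import Mathlib.Topology.KrullDimension
import HarnessLib

/-!
# ResolutionOfSingularities / UniversalCells — crux `LocalToGlobal`, line `birth` (v3):
# cover patching from two-model patching in bounded transcendence degree

Crux `stmt-ResolutionOfSingularities-15232`, decl `UniversalCells.LocalToGlobal`. Line birth v3
splits the crux by dimension; its dimension-`≤ n` slice rests on two-model patching of proper
models of function fields `K/k` of transcendence degree `≤ n` only. This file is the bookkeeping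
step: the landed `hasResolution_of_twoModelPatchingAt_of_cover`
(`UniversalCellsLocalToGlobalTwoModelPatchingAt.lean`) uses the patching hypothesis exactly once,
at `K = Frac A` for `A = Γ(W, ⊤)` the coordinate ring of a non-empty affine open `W ⊆ X`; by the
dimension theorem for affine domains (`exists_ringKrullDim_eq_and_trdeg_eq`,
`AffineDomainDimension.lean`) `trdeg_k K = trdeg_k A = dim A = dim Spec A ≤ dim X ≤ n`
(`Topology.IsInducing.topologicalKrullDim_le` along the open immersion `Spec A → X`), so the
patching hypothesis restricted to transcendence degree `≤ n` suffices when `dim X ≤ n`.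

* `stub_coverPatching_of_trdegLe` — two-model patching of proper models of function fields of
  transcendence degree `≤ n` over `k` + an open cover `X = U ∪ V` of an integral separated
  finite-type `k`-scheme of dimension `≤ n` with proper birational integral models `Z₁ → X`
  regular over `U`, `Z₂ → X` regular over `V` ⇒ `Scheme.HasResolution X`.

## References

* O. Piltant, RACSAM 107 (2013) 91–121, Prop. 5.1 and p. 2. [Piltant2013]
* H. Matsumura, *Commutative Ring Theory* (1987), Thm. 5.6. [Matsumura1987]
-/

-- `Summit.<Summit>.<Sub>.Theorems` with `Sub = Summit` (single-conjunct summit, D-0017)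
set_option linter.dupNamespace false

noncomputable section

open CategoryTheory CategoryTheory.Limits AlgebraicGeometry TopologicalSpace
open Literature.AlgebraicGeometry.Resolution Literature.AlgebraicGeometry.Morphisms

namespace Summit.ResolutionOfSingularities.ResolutionOfSingularities.Theorems

/-- **Two-model patching of proper models of function fields of transcendence degree `≤ n` over
`k` patches two partial resolutions over a Zariski cover of a `k`-variety of dimension `≤ n`.**
Let `k` be a field such that any two proper models of any function field `K/k` (essentially of
finite type) with `trdeg_k K ≤ n` are dominated by a proper model `RegLe` over both, `X` an
integral separated `k`-scheme of finite type with `dim X ≤ n`, `U ∪ V = X` an open cover, and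
`π₁ : Z₁ → X`, `π₂ : Z₂ → X` proper birational morphisms from INTEGRAL schemes with `Z₁` regular
at every point over `U` and `Z₂` regular at every point over `V`. Then `X` has a resolution of
singularities. Proof verbatim that of `hasResolution_of_twoModelPatchingAt_of_cover`
(compactify `X` by Nagata, extend `Zᵢ` to proper models of `K = Frac A` through a common affine
chart `Spec A`, patch, identify the two composites to `X̄` by uniqueness of domination, restrict
over `X`), the patching hypothesis being applied once, at `K = Frac A`, where
`trdeg_k K = trdeg_k A = dim A = dim Spec A ≤ dim X ≤ n` by the dimension theorem for affine
domains and monotonicity of dimension along the open immersion `Spec A → X`.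
[cite: Piltant2013, Prop. 5.1 (shape of two-model patching; this consequence is folklore)] -/
theorem stub_coverPatching_of_trdegLe (k : Type) [Field k] (n : ℕ)
    (hT : ∀ (K : Type) [Field K] [Algebra k K] [Algebra.EssFiniteType k K],
      Algebra.trdeg k K ≤ n → ∀ M₁ M₂ : ProperModel k K,
        ∃ (N : ProperModel k K) (φ₁ : N.Hom M₁) (φ₂ : N.Hom M₂), φ₁.RegLe ∧ φ₂.RegLe)
    (X : Scheme.{0}) (f : X ⟶ Spec (.of k)) [IsSeparated f] [LocallyOfFiniteType f]
    [QuasiCompact f] [IsIntegral X] (hX : topologicalKrullDim X ≤ n) (U V : X.Opens)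
    (hUV : U ⊔ V = ⊤) {Z₁ Z₂ : Scheme.{0}} [IsIntegral Z₁] [IsIntegral Z₂]
    (π₁ : Z₁ ⟶ X) (π₂ : Z₂ ⟶ X) [IsProper π₁] [IsProper π₂]
    (hb₁ : IsBirational π₁) (hb₂ : IsBirational π₂)
    (hr₁ : ∀ z : Z₁, π₁.base z ∈ U → IsRegularLocalRing (Z₁.presheaf.stalk z))
    (hr₂ : ∀ z : Z₂, π₂.base z ∈ V → IsRegularLocalRing (Z₂.presheaf.stalk z)) :
    Scheme.HasResolution X := by
  classical
  have hN : NagataCompactification.{0} := NagataCompactification_holds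
  /- Step 1: a common affine chart `Spec A` of `X` inside the iso-loci of `π₁` and `π₂`. -/
  obtain ⟨O₁, hO₁d, -, hO₁iso⟩ := hb₁
  obtain ⟨O₂, hO₂d, -, hO₂iso⟩ := hb₂
  haveI := hO₁iso
  haveI := hO₂iso
  haveI : Nonempty X := inferInstance
  have hO₁₂ : ((O₁ ⊓ O₂ : X.Opens) : Set X).Nonempty := by
    obtain ⟨x, hx⟩ := hO₂d.nonempty
    obtain ⟨y, hy₂, hy₁⟩ := hO₁d.inter_open_nonempty _ O₂.isOpen ⟨x, hx⟩
    exact ⟨y, hy₁, hy₂⟩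
  obtain ⟨x₀, hx₀⟩ := hO₁₂
  obtain ⟨_, ⟨W', hW, rfl⟩, hx₀W, hWO⟩ :=
    X.isBasis_affineOpens.exists_subset_of_mem_open hx₀ (O₁ ⊓ O₂).isOpen
  let W : X.Opens := W'
  haveI : IsAffine W := hW
  haveI : Nonempty W := ⟨⟨x₀, hx₀W⟩⟩
  have hWO₁ : W ≤ O₁ := fun x hx => (hWO hx).1
  have hWO₂ : W ≤ O₂ := fun x hx => (hWO hx).2
  let A : Type := Γ(W, ⊤)
  let fW : (W : Scheme.{0}) ⟶ Spec (.of k) := W.ι ≫ f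
  let ψ : k →+* A := fW.appTop.hom.comp (Scheme.ΓSpecIso (.of k)).inv.hom
  have hψ : ψ.FiniteType := by
    have h1 : fW.appTop.hom.FiniteType :=
      (HasRingHomProperty.iff_of_isAffine (P := @LocallyOfFiniteType)).mp inferInstance
    exact h1.comp (RingHom.FiniteType.of_surjective _
      (Scheme.ΓSpecIso (.of k)).symm.commRingCatIsoToRingEquiv.surjective)
  letI : Algebra k A := ψ.toAlgebra
  haveI hft : Algebra.FiniteType k A := hψ
  let K : Type := FractionRing A
  haveI : Algebra.EssFiniteType k K := inferInstance
  -- the chart of `X`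
  obtain ⟨jX, hjXdef⟩ : ∃ jX : Spec (.of A) ⟶ X, jX = W.toScheme.isoSpec.inv ≫ W.ι := ⟨_, rfl⟩
  haveI : IsOpenImmersion jX := by rw [hjXdef]; infer_instance
  have hjX : jX ≫ f = Spec.map (CommRingCat.ofHom (algebraMap k A)) := by
    rw [hjXdef, Category.assoc, isoSpec_inv_comp]
    rfl
  /- Step 1b: `trdeg_k K = trdeg_k A = dim A = dim Spec A ≤ dim X ≤ n`. -/
  have hKn : Algebra.trdeg k K ≤ n := by
    obtain ⟨m, hm, htr⟩ := exists_ringKrullDim_eq_and_trdeg_eq k A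
    have hAK : Algebra.trdeg k K = Algebra.trdeg k A := by
      haveI : Algebra.IsAlgebraic A K := IsLocalization.isAlgebraic K (nonZeroDivisors A)
      rw [← trdeg_add_eq k A (A := K), trdeg_eq_zero (R := A) (A := K), add_zero]
    have hdim : topologicalKrullDim (Spec (.of A)) ≤ n :=
      jX.isOpenEmbedding.isInducing.topologicalKrullDim_le.trans hX
    have hmn : (m : WithBot ℕ∞) ≤ n := by
      rw [← hm, ← PrimeSpectrum.topologicalKrullDim_eq_ringKrullDim]
      exact hdim
    have hmn' : m ≤ n := by exact_mod_cast hmn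
    rw [hAK, htr]
    exact_mod_cast hmn'
  -- the charts of `Z₁`, `Z₂`: `Spec A ≅ W ≅ πᵢ⁻¹ W ⊆ Zᵢ`
  haveI hπ₁W : IsIso (π₁ ∣_ W) := isIso_morphismRestrict_of_le π₁ hO₁iso hWO₁
  haveI hπ₂W : IsIso (π₂ ∣_ W) := isIso_morphismRestrict_of_le π₂ hO₂iso hWO₂
  obtain ⟨j₁, hj₁def⟩ : ∃ j₁ : Spec (.of A) ⟶ Z₁,
      j₁ = W.toScheme.isoSpec.inv ≫ inv (π₁ ∣_ W) ≫ (π₁ ⁻¹ᵁ W).ι := ⟨_, rfl⟩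
  obtain ⟨j₂, hj₂def⟩ : ∃ j₂ : Spec (.of A) ⟶ Z₂,
      j₂ = W.toScheme.isoSpec.inv ≫ inv (π₂ ∣_ W) ≫ (π₂ ⁻¹ᵁ W).ι := ⟨_, rfl⟩
  haveI : IsOpenImmersion j₁ := by rw [hj₁def]; infer_instance
  haveI : IsOpenImmersion j₂ := by rw [hj₂def]; infer_instance
  have hj₁π : j₁ ≫ π₁ = jX := by
    rw [hjXdef, hj₁def, Category.assoc, Category.assoc, ← morphismRestrict_ι,
      IsIso.inv_hom_id_assoc]
  have hj₂π : j₂ ≫ π₂ = jX := by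
    rw [hjXdef, hj₂def, Category.assoc, Category.assoc, ← morphismRestrict_ι,
      IsIso.inv_hom_id_assoc]
  /- Step 2: compactify `X`, extend `Z₁`, `Z₂` over the compactification. -/
  obtain ⟨Xb, sX, πX, hXb, hsX, hπX, hsXπ⟩ := exists_integral_compactification hN X f
  haveI := hXb; haveI := hsX; haveI := hπX
  haveI : IsLocallyNoetherian Xb := LocallyOfFiniteType.isLocallyNoetherian πX
  haveI : CompactSpace Xb := QuasiCompact.compactSpace_of_compactSpace πX
  haveI : IsNoetherian Xb := {}
  let e : X ≅ (sX.opensRange : Scheme.{0}) := sX.isoOpensRange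
  have he : e.hom ≫ sX.opensRange.ι = sX := Scheme.Hom.isoOpensRange_hom_ι sX
  haveI : IsProper (π₁ ≫ e.hom) := inferInstance
  haveI : IsProper (π₂ ≫ e.hom) := inferInstance
  obtain ⟨Zb₁, ρ₁, s₁, hZb₁, hρ₁, hs₁, -, hsq₁⟩ :=
    exists_isPullback_of_nagata hN sX.opensRange (π₁ ≫ e.hom)
  obtain ⟨Zb₂, ρ₂, s₂, hZb₂, hρ₂, hs₂, -, hsq₂⟩ :=
    exists_isPullback_of_nagata hN sX.opensRange (π₂ ≫ e.hom)
  haveI := hZb₁; haveI := hρ₁; haveI := hs₁; haveI := hZb₂; haveI := hρ₂; haveI := hs₂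
  have hsρ₁ : s₁ ≫ ρ₁ = π₁ ≫ sX := by rw [hsq₁.w, Category.assoc, he]
  have hsρ₂ : s₂ ≫ ρ₂ = π₂ ≫ sX := by rw [hsq₂.w, Category.assoc, he]
  /- Step 3: the three proper models of `K`. -/
  have hcX : (jX ≫ sX) ≫ πX = Spec.map (CommRingCat.ofHom (algebraMap k A)) := by
    rw [Category.assoc, hsXπ, hjX]
  have hc₁ : (j₁ ≫ s₁) ≫ (ρ₁ ≫ πX) = Spec.map (CommRingCat.ofHom (algebraMap k A)) := by
    rw [Category.assoc, ← Category.assoc s₁, hsρ₁, Category.assoc, hsXπ, ← Category.assoc,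
      hj₁π, hjX]
  have hc₂ : (j₂ ≫ s₂) ≫ (ρ₂ ≫ πX) = Spec.map (CommRingCat.ofHom (algebraMap k A)) := by
    rw [Category.assoc, ← Category.assoc s₂, hsρ₂, Category.assoc, hsXπ, ← Category.assoc,
      hj₂π, hjX]
  haveI : IsProper (ρ₁ ≫ πX) := inferInstance
  haveI : IsProper (ρ₂ ≫ πX) := inferInstance
  let PX : ProperModel k K := ProperModel.ofChart Xb πX A (jX ≫ sX) hcX
  let P₁ : ProperModel k K := ProperModel.ofChart Zb₁ (ρ₁ ≫ πX) A (j₁ ≫ s₁) hc₁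
  let P₂ : ProperModel k K := ProperModel.ofChart Zb₂ (ρ₂ ≫ πX) A (j₂ ≫ s₂) hc₂
  -- `ρᵢ` as morphisms of models `Pᵢ → PX`
  let τ₁ : P₁.Hom PX :=
    { f := ρ₁
      f_π := rfl
      gen_f := by
        change (Spec.map (CommRingCat.ofHom (algebraMap A K)) ≫ j₁ ≫ s₁) ≫ ρ₁ =
          Spec.map (CommRingCat.ofHom (algebraMap A K)) ≫ jX ≫ sX
        rw [Category.assoc, Category.assoc, hsρ₁, ← Category.assoc j₁, hj₁π] }
  let τ₂ : P₂.Hom PX :=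
    { f := ρ₂
      f_π := rfl
      gen_f := by
        change (Spec.map (CommRingCat.ofHom (algebraMap A K)) ≫ j₂ ≫ s₂) ≫ ρ₂ =
          Spec.map (CommRingCat.ofHom (algebraMap A K)) ≫ jX ≫ sX
        rw [Category.assoc, Category.assoc, hsρ₂, ← Category.assoc j₂, hj₂π] }
  /- Step 4: patch (the one use of two-model patching, at `K = Frac A`, `trdeg_k K ≤ n`). -/
  obtain ⟨N, φ₁, φ₂, h₁, h₂⟩ := hT K hKn P₁ P₂
  let χ : N.Hom PX := φ₁.comp τ₁
  have hχ₁ : χ.f = φ₁.f ≫ ρ₁ := rfl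
  have hχ₂ : χ.f = φ₂.f ≫ ρ₂ := ProperModel.Hom.f_eq χ (φ₂.comp τ₂)
  /- Step 5: the resolution of `X`: `χ` restricted over `X ≅ sX(X)`. -/
  let ρ : ((χ.f ⁻¹ᵁ sX.opensRange : N.X.Opens) : Scheme.{0}) ⟶ X :=
    (χ.f ∣_ sX.opensRange) ≫ e.inv
  refine ⟨_, ρ, ⟨inferInstance, (χ.isBirational.morphismRestrict sX.opensRange).comp_iso _, ?_⟩⟩
  intro y
  rw [SandwichedGluing.mem_regularLocus_opens_iff]
  obtain ⟨x, hx⟩ : ∃ x : X, sX x = χ.f y.1 := y.2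
  have hxUV : x ∈ U ⊔ V := by rw [hUV]; trivial
  have hex : (e.hom.base x).1 = sX.base x := by
    change ((e.hom ≫ sX.opensRange.ι).base x) = sX.base x
    rw [he]
  rcases hxUV with hxU | hxV
  · -- over `U`: regular because `Z̄₁` is regular over `U` and `φ₁` is `RegLe`
    refine h₁ y.1 ?_
    change IsRegularLocalRing (Zb₁.presheaf.stalk (φ₁.f y.1))
    refine isRegularLocalRing_stalk_of_extension e hsq₁ hr₁ (φ₁.f y.1) x hxU ?_
    change (φ₁.f ≫ ρ₁).base y.1 = _
    rw [← hχ₁, hex]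
    exact hx.symm
  · -- over `V`: regular because `Z̄₂` is regular over `V` and `φ₂` is `RegLe`
    refine h₂ y.1 ?_
    change IsRegularLocalRing (Zb₂.presheaf.stalk (φ₂.f y.1))
    refine isRegularLocalRing_stalk_of_extension e hsq₂ hr₂ (φ₂.f y.1) x hxV ?_
    change (φ₂.f ≫ ρ₂).base y.1 = _
    rw [← hχ₂, hex]
    exact hx.symm

end Summit.ResolutionOfSingularities.ResolutionOfSingularities.Theorems

end
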